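import Summits.PneNP.PneNP.Theorems.ChebyshevTracialDesignTwoBlockMixture
import Summits.PneNP.PneNP.Theorems.ChebyshevTracialDesignTiltedSmallBlockTools
import HarnessLib

/-!
# Cell pnp-psdrank, route `ChebyshevTracialDesign`: TILTED TWO SMALL BLOCKS — tools (brick 158a; crux `TracialDecayExp20`,
# stmt-PneNP-19878)

Brick 158a (prover g31; MEMO-33 §5 (P), MEMO-34 §2). The two-block companion of brick 151a (`…TiltedSmallBlockTools`). Two DISJOINT
blocks `H₁, H₂` on a `π`-stable ground set `S` with no edge of `S` inside `H₁ ∪ H₂`; a bivariate mask `Ψ(X₁, X₂)`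
(`X_i = |U ∩ H_i|`, `Y_i = |half U ∩ H_i|`) tilted by the two-block crossing-plane form `(2λ₁(X₁−Y₁) + 2λ₂(X₂−Y₂) + L − κc)²`:

* §1 half-pinning AVERAGES of a general cut function (`shellInAvg_halfCount_mul_eq`, `shellInAvg_halfPairs_mul_eq`: lit's sum identities
  `sum_shellIn_halfCount_mul_eq` / `sum_shellIn_halfPairs_mul_eq` divided by the shell sizes), the NEW cross identity
  **`sum_shellIn_halfCross_mul_eq`** / `shellInAvg_halfCross_mul_eq` (`Σ_U Y₁Y₂·g(U) = Σ_{v∈S∩H₁}Σ_{w∈S∩H₂}Σ_{W∈Shell_{S∖e_v∖e_w}} g(W+w+v)`,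
  two half-matched vertices on different edges pinned, lit `sum_shellIn_half_half_eq`), and their bivariate all-level forms
  `avg_halfCount_fst_eq`, `avg_halfPairs_fst_eq`, `avg_halfCross_eq` (the pinned mask is `Ψ` shifted in the pinned coordinates).
* §2 **`piece_abs_le₂`**, **`piece_main_le₂`** — brick 151a's piece lemmas for BIVARIATE masks: the shell average of `Φ(X₁,X₂)` is
  the shell average of its hypergeometric mixture `Φ̄(X)` on the union block (brick 157b `shellInAvg_two_blocks_eq`), a univariate
  mask with `|Φ̄| ≤ G`, `Φ̄ ≥ 0`; so a polynomially weighted level sum of a bivariate piece with vanishing virtual weight is pure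
  remainder, and the main piece is priced one-sidedly.
WHAT THIS FILE DOES NOT DO: the twelve-term expansion and the level sum (158b), the assembly (158); anything on `TracialDecayExp20` itself, psd rank
of P_PM(K_n), or P vs NP. [cite: Rothvoss2017, §2 (PDF p. 6)] [cite: Agarwal2000DifferenceEquations, Remark 1.8.1 (1.8.8)]
[cite: RollinRoss2010, §3 (Lemma 3.1)]
Stature: support/instrument (kernel lane, no defs, axioms standard). Supports stmt-PneNP-19878.
-/

set_option linter.dupNamespace false -- `Summit.PneNP.PneNP.…`: summit = sub-problem (D-0017)

noncomputable section

namespace Summit.PneNP.PneNP.Theorems.ChebyshevTracialDesignTwoBlockTools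

open Finset Polynomial Literature.Barriers.PneNP Literature.Combinatorics.Optimization
open Literature.Combinatorics.Optimization.ShellStep
open Summit.PneNP.PneNP.Theorems.ChebyshevTracialDesignTiltedSmallBlockTools (piece_abs_le piece_main_le)
open Summit.PneNP.PneNP.Theorems.ChebyshevTracialDesignBlockEdgeSwaps (no_internal_edge_of_reps_vAA card_reps_vB_eq_card_inter)
open Summit.PneNP.PneNP.Theorems.ChebyshevTracialDesignTwoBlockMixture (shellInAvg_two_blocks_eq abs_mixture_le mixture_nonneg)

variable {n : ℕ}

/-! ### §1 Half-pinning averages of a general cut function and of bivariate masks -/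

section HalfAvg

variable {π : Fin n → Fin n} (hπ : ∀ v, π (π v) = v) (hπ' : ∀ v, π v ≠ v)
include hπ hπ'

/-- **Half-count average of a general cut function**: for a stable `S` and `Shell_S(t+1,c+1) ≠ ∅`,
`E_{Shell_S(t+1,c+1)}[|half U ∩ H|·g(U)] = ((c+1)/|S|)·Σ_{v ∈ S∩H} E_{Shell_{S∖e_v}(t,c)}[g(W + v)]`.
[cite: Rothvoss2017, §2 (PDF p. 6)] -/
theorem shellInAvg_halfCount_mul_eq {S : Finset (Fin n)} (hS : ∀ u ∈ S, π u ∈ S) (H : Finset (Fin n)) (t c : ℕ)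
    (g : Finset (Fin n) → ℝ) (hne : (shellIn π S (t + 1) (c + 1)).Nonempty) :
    (∑ U ∈ shellIn π S (t + 1) (c + 1), ((half π U ∩ H).card : ℝ) * g U) / ((shellIn π S (t + 1) (c + 1)).card : ℝ) =
      (((c : ℝ) + 1) / (S.card : ℝ)) * ∑ v ∈ S ∩ H,
        (∑ W ∈ shellIn π (S \ {v, π v}) t c, g (insert v W)) / ((shellIn π (S \ {v, π v}) t c).card : ℝ) := by
  rw [sum_shellIn_halfCount_mul_eq hπ hπ' S H t c g, sum_div, mul_sum]
  refine sum_congr rfl fun v hv => ?_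
  have hvS : v ∈ S := (mem_inter.1 hv).1
  have hr := card_shellIn_sdiff_pair_half_ratio hπ hπ' hS hvS t c
  have hA : (0 : ℝ) < (shellIn π S (t + 1) (c + 1)).card := by exact_mod_cast hne.card_pos
  have hB : (0 : ℝ) < (shellIn π (S \ {v, π v}) t c).card := by
    exact_mod_cast (shellIn_sdiff_pair_nonempty_of_half hπ hπ' hS hvS hne).card_pos
  have hSpos : (0 : ℝ) < S.card := by exact_mod_cast card_pos.2 ⟨v, hvS⟩
  rw [div_mul_div_comm, div_eq_div_iff hA.ne' (mul_ne_zero hSpos.ne' hB.ne')]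
  linear_combination (∑ W ∈ shellIn π (S \ {v, π v}) t c, g (insert v W)) * hr

/-- **Half-pair average of a general cut function**: for a stable `S` and `Shell_S(t+2,c+2) ≠ ∅`,
`E_{Shell_S(t+2,c+2)}[Y(Y−1)·g(U)] = ((c+2)(c+1)/(|S|(|S|−2)))·Σ_{v∈S∩H} Σ_{w∈(S∩H)∖e_v} E_{Shell_{S∖e_v∖e_w}(t,c)}[g(W+w+v)]`
(`Y = |half U ∩ H|`). [cite: Rothvoss2017, §2 (PDF p. 6)] -/
theorem shellInAvg_halfPairs_mul_eq {S : Finset (Fin n)} (hS : ∀ u ∈ S, π u ∈ S) (H : Finset (Fin n)) (t c : ℕ)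
    (g : Finset (Fin n) → ℝ) (hne : (shellIn π S (t + 2) (c + 2)).Nonempty) :
    (∑ U ∈ shellIn π S (t + 2) (c + 2), ((half π U ∩ H).card : ℝ) * (((half π U ∩ H).card : ℝ) - 1) * g U) /
        ((shellIn π S (t + 2) (c + 2)).card : ℝ) =
      ((((c : ℝ) + 2) * ((c : ℝ) + 1)) / ((S.card : ℝ) * ((S.card : ℝ) - 2))) *
        ∑ v ∈ S ∩ H, ∑ w ∈ (S ∩ H) \ {v, π v},
          (∑ W ∈ shellIn π (del2 π S v w) t c, g (insert v (insert w W))) /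
            ((shellIn π (del2 π S v w) t c).card : ℝ) := by
  rw [sum_shellIn_halfPairs_mul_eq hπ hπ' S H t c g, sum_div, mul_sum]
  refine sum_congr rfl fun v hv => ?_
  rw [sum_div, mul_sum]
  refine sum_congr rfl fun w hw => ?_
  have hvS : v ∈ S := (mem_inter.1 hv).1
  obtain ⟨hwSH, hwe⟩ := mem_sdiff.1 hw
  rw [mem_insert, mem_singleton, not_or] at hwe
  have hwS : w ∈ S := (mem_inter.1 hwSH).1
  have hr := card_shellIn_del2_half_ratio hπ hπ' hS hvS hwS hwe.1 hwe.2 t c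
  have hS4 : t + 2 + (c + 2) ≤ S.card := by obtain ⟨U, hU⟩ := hne; exact add_le_of_mem_shellIn hπ hS hU
  have h4 : (4 : ℝ) ≤ S.card := by exact_mod_cast (show 4 ≤ S.card by omega)
  have hden : 0 < (S.card : ℝ) * ((S.card : ℝ) - 2) := mul_pos (by linarith) (by linarith)
  have hA : (0 : ℝ) < (shellIn π S (t + 2) (c + 2)).card := by exact_mod_cast hne.card_pos
  have hB : (0 : ℝ) < (shellIn π (del2 π S v w) t c).card := by
    exact_mod_cast (shellIn_del2_nonempty_of_half hπ hπ' hS hvS hwS hwe.1 hwe.2 hne).card_pos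
  rw [div_mul_div_comm, div_eq_div_iff hA.ne' (mul_ne_zero hden.ne' hB.ne')]
  linear_combination (∑ W ∈ shellIn π (del2 π S v w) t c, g (insert v (insert w W))) * hr

omit hπ hπ' in
/-- The half count of a block as an indicator sum over the block vertices of the ground set. [cite: Rothvoss2017, §2 (PDF p. 5)] -/
theorem halfCount_eq_sum_indicator {S H U : Finset (Fin n)} (hUS : U ⊆ S) :
    ((half π U ∩ H).card : ℝ) = ∑ v ∈ S ∩ H, (if (v ∈ U ∧ π v ∉ U) then (1 : ℝ) else 0) := by
  rw [half_inter_eq_filter hUS, card_filter]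
  push_cast
  exact sum_congr rfl fun v _ => by split_ifs <;> simp

/-- **Cross half-count sums split over the pinned pair**: for blocks `H₁, H₂` whose `S`-vertices lie on pairwise different
edges (`w ∉ e_v` for `v ∈ S∩H₁`, `w ∈ S∩H₂`),
`Σ_{U ∈ Shell_S(t+2,c+2)} |half U ∩ H₁|·|half U ∩ H₂|·g(U) = Σ_{v∈S∩H₁} Σ_{w∈S∩H₂} Σ_{W ∈ Shell_{S∖e_v∖e_w}(t,c)} g(W+w+v)`.
[cite: Rothvoss2017, §2 (PDF p. 6)] -/
theorem sum_shellIn_halfCross_mul_eq (S H₁ H₂ : Finset (Fin n))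
    (hsep : ∀ v ∈ S ∩ H₁, ∀ w ∈ S ∩ H₂, w ≠ v ∧ w ≠ π v) (t c : ℕ) (g : Finset (Fin n) → ℝ) :
    ∑ U ∈ shellIn π S (t + 2) (c + 2), ((half π U ∩ H₁).card : ℝ) * ((half π U ∩ H₂).card : ℝ) * g U =
      ∑ v ∈ S ∩ H₁, ∑ w ∈ S ∩ H₂, ∑ W ∈ shellIn π (del2 π S v w) t c, g (insert v (insert w W)) := by
  calc ∑ U ∈ shellIn π S (t + 2) (c + 2), ((half π U ∩ H₁).card : ℝ) * ((half π U ∩ H₂).card : ℝ) * g U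
      = ∑ U ∈ shellIn π S (t + 2) (c + 2), ∑ v ∈ S ∩ H₁, ∑ w ∈ S ∩ H₂,
          (if (v ∈ U ∧ π v ∉ U) then (1 : ℝ) else 0) * (if (w ∈ U ∧ π w ∉ U) then (1 : ℝ) else 0) * g U := by
        refine sum_congr rfl fun U hU => ?_
        rw [halfCount_eq_sum_indicator (mem_shellIn.1 hU).1, halfCount_eq_sum_indicator (mem_shellIn.1 hU).1,
          sum_mul, sum_mul]
        refine sum_congr rfl fun v _ => ?_
        rw [mul_sum, sum_mul]
    _ = ∑ v ∈ S ∩ H₁, ∑ U ∈ shellIn π S (t + 2) (c + 2), ∑ w ∈ S ∩ H₂,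
          (if (v ∈ U ∧ π v ∉ U) then (1 : ℝ) else 0) * (if (w ∈ U ∧ π w ∉ U) then (1 : ℝ) else 0) * g U := sum_comm
    _ = ∑ v ∈ S ∩ H₁, ∑ w ∈ S ∩ H₂, ∑ U ∈ shellIn π S (t + 2) (c + 2),
          (if (v ∈ U ∧ π v ∉ U) then (1 : ℝ) else 0) * (if (w ∈ U ∧ π w ∉ U) then (1 : ℝ) else 0) * g U :=
        sum_congr rfl fun v _ => sum_comm
    _ = _ := by
        refine sum_congr rfl fun v hv => sum_congr rfl fun w hw => ?_
        obtain ⟨hwv, hwπ⟩ := hsep v hv w hw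
        rw [← sum_shellIn_half_half_eq hπ hπ' (mem_inter.1 hv).1 (mem_inter.1 hw).1 hwv hwπ t c g, sum_filter]
        refine sum_congr rfl fun U _ => ?_
        by_cases h1 : v ∈ U ∧ π v ∉ U
        · by_cases h2 : w ∈ U ∧ π w ∉ U
          · rw [if_pos h1, if_pos h2, if_pos ⟨h1, h2⟩]; ring
          · rw [if_neg h2, if_neg (show ¬((v ∈ U ∧ π v ∉ U) ∧ (w ∈ U ∧ π w ∉ U)) from fun h => h2 h.2)]; ring
        · rw [if_neg h1, if_neg (show ¬((v ∈ U ∧ π v ∉ U) ∧ (w ∈ U ∧ π w ∉ U)) from fun h => h1 h.1)]; ring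

/-- **Cross half-count average**: for a stable `S`, blocks on pairwise different edges, `Shell_S(t+2,c+2) ≠ ∅`:
`E_{Shell_S(t+2,c+2)}[Y₁Y₂·g(U)] = ((c+2)(c+1)/(|S|(|S|−2)))·Σ_{v∈S∩H₁} Σ_{w∈S∩H₂} E_{Shell_{S∖e_v∖e_w}(t,c)}[g(W+w+v)]`.
[cite: Rothvoss2017, §2 (PDF p. 6)] -/
theorem shellInAvg_halfCross_mul_eq {S : Finset (Fin n)} (hS : ∀ u ∈ S, π u ∈ S) (H₁ H₂ : Finset (Fin n))
    (hsep : ∀ v ∈ S ∩ H₁, ∀ w ∈ S ∩ H₂, w ≠ v ∧ w ≠ π v) (t c : ℕ) (g : Finset (Fin n) → ℝ)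
    (hne : (shellIn π S (t + 2) (c + 2)).Nonempty) :
    (∑ U ∈ shellIn π S (t + 2) (c + 2), ((half π U ∩ H₁).card : ℝ) * ((half π U ∩ H₂).card : ℝ) * g U) /
        ((shellIn π S (t + 2) (c + 2)).card : ℝ) =
      ((((c : ℝ) + 2) * ((c : ℝ) + 1)) / ((S.card : ℝ) * ((S.card : ℝ) - 2))) *
        ∑ v ∈ S ∩ H₁, ∑ w ∈ S ∩ H₂,
          (∑ W ∈ shellIn π (del2 π S v w) t c, g (insert v (insert w W))) /
            ((shellIn π (del2 π S v w) t c).card : ℝ) := by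
  rw [sum_shellIn_halfCross_mul_eq hπ hπ' S H₁ H₂ hsep t c g, sum_div, mul_sum]
  refine sum_congr rfl fun v hv => ?_
  rw [sum_div, mul_sum]
  refine sum_congr rfl fun w hw => ?_
  have hvS : v ∈ S := (mem_inter.1 hv).1
  have hwS : w ∈ S := (mem_inter.1 hw).1
  obtain ⟨hwv, hwπ⟩ := hsep v hv w hw
  have hr := card_shellIn_del2_half_ratio hπ hπ' hS hvS hwS hwv hwπ t c
  have hS4 : t + 2 + (c + 2) ≤ S.card := by obtain ⟨U, hU⟩ := hne; exact add_le_of_mem_shellIn hπ hS hU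
  have h4 : (4 : ℝ) ≤ S.card := by exact_mod_cast (show 4 ≤ S.card by omega)
  have hden : 0 < (S.card : ℝ) * ((S.card : ℝ) - 2) := mul_pos (by linarith) (by linarith)
  have hA : (0 : ℝ) < (shellIn π S (t + 2) (c + 2)).card := by exact_mod_cast hne.card_pos
  have hB : (0 : ℝ) < (shellIn π (del2 π S v w) t c).card := by
    exact_mod_cast (shellIn_del2_nonempty_of_half hπ hπ' hS hvS hwS hwv hwπ hne).card_pos
  rw [div_mul_div_comm, div_eq_div_iff hA.ne' (mul_ne_zero hden.ne' hB.ne')]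
  linear_combination (∑ W ∈ shellIn π (del2 π S v w) t c, g (insert v (insert w W))) * hr

omit hπ hπ' in
/-- Block counts after pinning a vertex of the FIRST of two disjoint blocks: `X₁(W + v) = X₁(W) + 1`, `X₂(W + v) = X₂(W)`.
[cite: Rothvoss2017, §2 (PDF p. 5)] -/
theorem card_insert_inter_two {H₁ H₂ W : Finset (Fin n)} (hdisj : Disjoint H₁ H₂) {v : Fin n} (hv : v ∈ H₁) (hvW : v ∉ W) :
    ((insert v W ∩ H₁).card : ℤ) = ((W ∩ H₁).card : ℤ) + 1 ∧ ((insert v W ∩ H₂).card : ℤ) = ((W ∩ H₂).card : ℤ) := by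
  rw [card_insert_inter_cast H₁ hvW, card_insert_inter_cast H₂ hvW, if_pos hv, if_neg (disjoint_left.1 hdisj hv), add_zero]
  exact ⟨rfl, rfl⟩

/-- **`E[Y₁·Φ(X₁,X₂)]`, all levels** (`t' ≥ 1`; the shell nonempty when `c' ≥ 1`): for disjoint blocks,
`E_{Shell_S(t',c')}[Y₁Φ(X₁,X₂)] = (c'/|S|)·Σ_{v∈S∩H₁} E_{Shell_{S∖e_v}(t'−1,c'−1)}[Φ(X₁+1,X₂)]`. [cite: Rothvoss2017, §2 (PDF p. 6)] -/
theorem avg_halfCount_fst_eq {S : Finset (Fin n)} (hS : ∀ u ∈ S, π u ∈ S) {H₁ H₂ : Finset (Fin n)} (hdisj : Disjoint H₁ H₂)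
    {t' : ℕ} (ht' : 1 ≤ t') (c' : ℕ) (Φ : ℤ → ℤ → ℝ) (hne : 1 ≤ c' → (shellIn π S t' c').Nonempty) :
    (∑ U ∈ shellIn π S t' c', ((half π U ∩ H₁).card : ℝ) * Φ ((U ∩ H₁).card : ℤ) ((U ∩ H₂).card : ℤ)) /
        ((shellIn π S t' c').card : ℝ) =
      ((c' : ℝ) / (S.card : ℝ)) * ∑ v ∈ S ∩ H₁,
        (∑ W ∈ shellIn π (S \ {v, π v}) (t' - 1) (c' - 1), Φ (((W ∩ H₁).card : ℤ) + 1) ((W ∩ H₂).card : ℤ)) /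
          ((shellIn π (S \ {v, π v}) (t' - 1) (c' - 1)).card : ℝ) := by
  rcases Nat.eq_zero_or_pos c' with rfl | hc
  · have h0 : ∀ U ∈ shellIn π S t' 0, ((half π U ∩ H₁).card : ℝ) * Φ ((U ∩ H₁).card : ℤ) ((U ∩ H₂).card : ℤ) = 0 := by
      intro U hU
      have h := (mem_shellIn.1 hU).2.2
      rw [card_eq_zero] at h
      rw [h, empty_inter, card_empty, Nat.cast_zero, zero_mul]
    rw [sum_congr rfl h0, sum_const_zero, zero_div, Nat.cast_zero, zero_div, zero_mul]
  · obtain ⟨t, rfl⟩ : ∃ t, t' = t + 1 := ⟨t' - 1, by omega⟩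
    obtain ⟨c, rfl⟩ : ∃ c, c' = c + 1 := ⟨c' - 1, by omega⟩
    rw [shellInAvg_halfCount_mul_eq hπ hπ' hS H₁ t c _ (hne hc), Nat.add_sub_cancel, Nat.add_sub_cancel]
    push_cast
    congr 1
    refine sum_congr rfl fun v hv => ?_
    congr 1
    refine sum_congr rfl fun W hW => ?_
    have hvW : v ∉ W := fun h => by have := mem_sdiff.1 ((mem_shellIn.1 hW).1 h); simp at this
    obtain ⟨e1, e2⟩ := card_insert_inter_two hdisj (mem_inter.1 hv).2 hvW
    rw [e1, e2]

/-- **`E[Y₁(Y₁−1)·Φ(X₁,X₂)]`, all levels** (`t' ≥ 2`; the shell nonempty when `c' ≥ 2`): for disjoint blocks,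
`= (c'(c'−1)/(|S|(|S|−2)))·Σ_{v∈S∩H₁} Σ_{w∈(S∩H₁)∖e_v} E_{Shell_{S∖e_v∖e_w}(t'−2,c'−2)}[Φ(X₁+2,X₂)]`.
[cite: Rothvoss2017, §2 (PDF p. 6)] -/
theorem avg_halfPairs_fst_eq {S : Finset (Fin n)} (hS : ∀ u ∈ S, π u ∈ S) {H₁ H₂ : Finset (Fin n)} (hdisj : Disjoint H₁ H₂)
    {t' : ℕ} (ht' : 2 ≤ t') (c' : ℕ) (Φ : ℤ → ℤ → ℝ) (hne : 2 ≤ c' → (shellIn π S t' c').Nonempty) :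
    (∑ U ∈ shellIn π S t' c', ((half π U ∩ H₁).card : ℝ) * (((half π U ∩ H₁).card : ℝ) - 1) *
        Φ ((U ∩ H₁).card : ℤ) ((U ∩ H₂).card : ℤ)) / ((shellIn π S t' c').card : ℝ) =
      (((c' : ℝ) * ((c' : ℝ) - 1)) / ((S.card : ℝ) * ((S.card : ℝ) - 2))) * ∑ v ∈ S ∩ H₁, ∑ w ∈ (S ∩ H₁) \ {v, π v},
        (∑ W ∈ shellIn π (del2 π S v w) (t' - 2) (c' - 2), Φ (((W ∩ H₁).card : ℤ) + 2) ((W ∩ H₂).card : ℤ)) /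
          ((shellIn π (del2 π S v w) (t' - 2) (c' - 2)).card : ℝ) := by
  rcases lt_or_ge c' 2 with hc | hc
  · have h0 : ∀ U ∈ shellIn π S t' c', ((half π U ∩ H₁).card : ℝ) * (((half π U ∩ H₁).card : ℝ) - 1) *
        Φ ((U ∩ H₁).card : ℤ) ((U ∩ H₂).card : ℤ) = 0 := by
      intro U hU
      have h := (mem_shellIn.1 hU).2.2
      have hY : (half π U ∩ H₁).card ≤ 1 := (card_le_card inter_subset_left).trans (by omega)
      interval_cases hY' : (half π U ∩ H₁).card <;> simp
    rw [sum_congr rfl h0, sum_const_zero, zero_div]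
    have hz : (c' : ℝ) * ((c' : ℝ) - 1) = 0 := by interval_cases c' <;> simp
    rw [hz, zero_div, zero_mul]
  · obtain ⟨t, rfl⟩ : ∃ t, t' = t + 2 := ⟨t' - 2, by omega⟩
    obtain ⟨c, rfl⟩ : ∃ c, c' = c + 2 := ⟨c' - 2, by omega⟩
    rw [shellInAvg_halfPairs_mul_eq hπ hπ' hS H₁ t c _ (hne hc), Nat.add_sub_cancel, Nat.add_sub_cancel]
    push_cast
    rw [show ((c : ℝ) + 2) * ((c : ℝ) + 2 - 1) = ((c : ℝ) + 2) * ((c : ℝ) + 1) by ring]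
    congr 1
    refine sum_congr rfl fun v hv => sum_congr rfl fun w hw => ?_
    congr 1
    refine sum_congr rfl fun W hW => ?_
    obtain ⟨hwSH, hwe⟩ := mem_sdiff.1 hw
    rw [mem_insert, mem_singleton, not_or] at hwe
    have hWsub := (mem_shellIn.1 hW).1
    have hwW : w ∉ W := fun h => by have := (mem_del2.1 (hWsub h)); exact this.2.2.2.1 rfl
    have hvW : v ∉ insert w W := by
      rw [mem_insert, not_or]
      refine ⟨fun e => hwe.1 e.symm, fun h => ?_⟩
      have := (mem_del2.1 (hWsub h)); exact this.2.1 rfl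
    obtain ⟨e1, e2⟩ := card_insert_inter_two hdisj (mem_inter.1 hv).2 hvW
    obtain ⟨e3, e4⟩ := card_insert_inter_two hdisj (mem_inter.1 hwSH).2 hwW
    rw [e1, e2, e3, e4, add_assoc]
    norm_num

/-- **`E[Y₁Y₂·Φ(X₁,X₂)]`, all levels** (`t' ≥ 2`; the shell nonempty when `c' ≥ 2`): for disjoint blocks on pairwise different
edges, `= (c'(c'−1)/(|S|(|S|−2)))·Σ_{v∈S∩H₁} Σ_{w∈S∩H₂} E_{Shell_{S∖e_v∖e_w}(t'−2,c'−2)}[Φ(X₁+1,X₂+1)]`.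
[cite: Rothvoss2017, §2 (PDF p. 6)] -/
theorem avg_halfCross_eq {S : Finset (Fin n)} (hS : ∀ u ∈ S, π u ∈ S) {H₁ H₂ : Finset (Fin n)} (hdisj : Disjoint H₁ H₂)
    (hsep : ∀ v ∈ S ∩ H₁, ∀ w ∈ S ∩ H₂, w ≠ v ∧ w ≠ π v)
    {t' : ℕ} (ht' : 2 ≤ t') (c' : ℕ) (Φ : ℤ → ℤ → ℝ) (hne : 2 ≤ c' → (shellIn π S t' c').Nonempty) :
    (∑ U ∈ shellIn π S t' c', ((half π U ∩ H₁).card : ℝ) * ((half π U ∩ H₂).card : ℝ) *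
        Φ ((U ∩ H₁).card : ℤ) ((U ∩ H₂).card : ℤ)) / ((shellIn π S t' c').card : ℝ) =
      (((c' : ℝ) * ((c' : ℝ) - 1)) / ((S.card : ℝ) * ((S.card : ℝ) - 2))) * ∑ v ∈ S ∩ H₁, ∑ w ∈ S ∩ H₂,
        (∑ W ∈ shellIn π (del2 π S v w) (t' - 2) (c' - 2), Φ (((W ∩ H₁).card : ℤ) + 1) (((W ∩ H₂).card : ℤ) + 1)) /
          ((shellIn π (del2 π S v w) (t' - 2) (c' - 2)).card : ℝ) := by
  rcases lt_or_ge c' 2 with hc | hc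
  · -- at most one half vertex in total: `Y₁Y₂ = 0`
    have h0 : ∀ U ∈ shellIn π S t' c', ((half π U ∩ H₁).card : ℝ) * ((half π U ∩ H₂).card : ℝ) *
        Φ ((U ∩ H₁).card : ℤ) ((U ∩ H₂).card : ℤ) = 0 := by
      intro U hU
      have h := (mem_shellIn.1 hU).2.2
      have hsum : (half π U ∩ H₁).card + (half π U ∩ H₂).card ≤ 1 := by
        rw [← card_union_of_disjoint (disjoint_of_subset_left inter_subset_right
          (disjoint_of_subset_right inter_subset_right hdisj)), ← inter_union_distrib_left]
        exact (card_le_card inter_subset_left).trans (by omega)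
      rcases Nat.eq_zero_or_pos (half π U ∩ H₁).card with h1 | h1
      · rw [h1, Nat.cast_zero, zero_mul, zero_mul]
      · have h2 : (half π U ∩ H₂).card = 0 := by omega
        rw [h2, Nat.cast_zero, mul_zero, zero_mul]
    rw [sum_congr rfl h0, sum_const_zero, zero_div]
    have hz : (c' : ℝ) * ((c' : ℝ) - 1) = 0 := by interval_cases c' <;> simp
    rw [hz, zero_div, zero_mul]
  · obtain ⟨t, rfl⟩ : ∃ t, t' = t + 2 := ⟨t' - 2, by omega⟩
    obtain ⟨c, rfl⟩ : ∃ c, c' = c + 2 := ⟨c' - 2, by omega⟩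
    rw [shellInAvg_halfCross_mul_eq hπ hπ' hS H₁ H₂ hsep t c _ (hne hc), Nat.add_sub_cancel, Nat.add_sub_cancel]
    push_cast
    rw [show ((c : ℝ) + 2) * ((c : ℝ) + 2 - 1) = ((c : ℝ) + 2) * ((c : ℝ) + 1) by ring]
    congr 1
    refine sum_congr rfl fun v hv => sum_congr rfl fun w hw => ?_
    congr 1
    refine sum_congr rfl fun W hW => ?_
    obtain ⟨hwv, hwπ⟩ := hsep v hv w hw
    have hWsub := (mem_shellIn.1 hW).1
    have hwW : w ∉ W := fun h => by have := (mem_del2.1 (hWsub h)); exact this.2.2.2.1 rfl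
    have hvW : v ∉ insert w W := by
      rw [mem_insert, not_or]
      refine ⟨fun e => hwv e.symm, fun h => ?_⟩
      have := (mem_del2.1 (hWsub h)); exact this.2.1 rfl
    obtain ⟨e1, e2⟩ := card_insert_inter_two hdisj (mem_inter.1 hv).2 hvW
    obtain ⟨e3, e4⟩ := card_insert_inter_two hdisj.symm (mem_inter.1 hw).2 hwW
    rw [e1, e2, e4, e3]

end HalfAvg

/-! ### §2 Pricing one piece with a bivariate mask -/

section Piece

variable {π : Fin n → Fin n} (hπ : ∀ v, π (π v) = v) (hπ' : ∀ v, π v ≠ v)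
include hπ hπ'

/-- **A bivariate piece with vanishing virtual weight is pure remainder.** As brick 151a `piece_abs_le`, for two DISJOINT blocks
`H₁, H₂` with no edge of `S` inside `H₁ ∪ H₂` and `b' ≤ b` edges meeting it, and a bivariate mask `|Φ(x₁,x₂)| ≤ G` for
`x₁ + x₂ ≤ b`: `|Σ_c w_c p(c)·E_{Shell_S(2s₀+c₀, c−g)}[Φ(X₁,X₂)]| ≤ B_v·P·C((T−1)/2, D′+1)·G·(¼(b/R)²e^{3b/R})^{D′+1}`
(the shell average of `Φ` is that of its hypergeometric mixture, brick 157b, a univariate mask of the union block bounded by `G`).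
[cite: Agarwal2000DifferenceEquations, Remark 1.8.1 (1.8.8)] [cite: RollinRoss2010, §3 (Lemma 3.1)] -/
theorem piece_abs_le₂ {t T D : ℕ} {Bv : ℝ} {C : Finset ℕ} {w : ℕ → ℝ} (hdes : IsExactDesign n t T D Bv C w)
    {S : Finset (Fin n)} (hS : ∀ v ∈ S, π v ∈ S) {N' : ℕ} (hN : S.card = 2 * N')
    {H₁ H₂ : Finset (Fin n)} (hdisj : Disjoint H₁ H₂) (h0 : (reps π (vAA π S (H₁ ∪ H₂))).card = 0)
    {b b' : ℕ} (hb' : (reps π (vBH π S (H₁ ∪ H₂) ∪ vBN π S (H₁ ∪ H₂))).card = b') (hb'b : b' ≤ b)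
    {s₀ c₀ i₀ g D' R : ℕ} (hc₀ : 2 * i₀ + 1 = g + c₀) (hR : 1 ≤ R)
    (hR1 : R + 3 * (D' + 1) + b + (T - 1) / 2 ≤ s₀ + 1)
    (hR2 : R + 3 * (D' + 1) + b + s₀ + (T - 1) / 2 + c₀ ≤ N')
    (Φ : ℤ → ℤ → ℝ) {G : ℝ} (hG : ∀ x₁ x₂ : ℕ, x₁ + x₂ ≤ b → |Φ x₁ x₂| ≤ G)
    (p : ℝ[X]) (hdeg : p.natDegree + D' ≤ D) (hpz : p.eval 0 = 0)
    (hp0 : ∀ c ∈ C, c < 2 * i₀ + 1 → p.eval (c : ℝ) = 0) {P : ℝ} (hP : ∀ c ∈ C, |p.eval (c : ℝ)| ≤ P) :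
    |∑ c ∈ C, w c * (p.eval (c : ℝ) *
        ((∑ U ∈ shellIn π S (2 * s₀ + c₀) (c - g), Φ ((U ∩ H₁).card : ℤ) ((U ∩ H₂).card : ℤ)) /
          ((shellIn π S (2 * s₀ + c₀) (c - g)).card : ℝ)))| ≤
      Bv * P * ((((T - 1) / 2).choose (D' + 1) : ℕ) : ℝ) *
        (G * ((1 / 4 : ℝ) * ((b : ℝ) / R) ^ 2 * Real.exp (3 * b / R)) ^ (D' + 1)) := by
  have hno := no_internal_edge_of_reps_vAA hπ hπ' hS (H₁ ∪ H₂) h0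
  have hbb : (S ∩ H₁).card + (S ∩ H₂).card ≤ b := by
    rw [Summit.PneNP.PneNP.Theorems.ChebyshevTracialDesignTwoBlockMixture.card_inter_add_card_inter_eq hdisj S,
      ← card_reps_vB_eq_card_inter hπ hπ' hS (H₁ ∪ H₂) hno, hb']
    exact hb'b
  -- the mixture mask
  set ψ : ℤ → ℝ := fun x => ∑ x₁ ∈ range ((S ∩ H₁).card + 1), ∑ x₂ ∈ range ((S ∩ H₂).card + 1),
    (if ((x₁ + x₂ : ℕ) : ℤ) = x then (((S ∩ H₁).card.choose x₁ * (S ∩ H₂).card.choose x₂ : ℕ) : ℝ) /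
      ((((S ∩ H₁).card + (S ∩ H₂).card).choose (x₁ + x₂) : ℕ) : ℝ) else 0) * Φ x₁ x₂ with hψ
  have hGr : ∀ x₁ ∈ range ((S ∩ H₁).card + 1), ∀ x₂ ∈ range ((S ∩ H₂).card + 1), |Φ x₁ x₂| ≤ G := by
    intro x₁ hx₁ x₂ hx₂
    rw [mem_range] at hx₁ hx₂
    exact hG x₁ x₂ (by omega)
  have hψG : ∀ x ∈ Icc (0 : ℤ) ((2 * s₀ + c₀ : ℕ) : ℤ), |ψ x| ≤ G := fun x _ => abs_mixture_le _ _ Φ hGr x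
  have hrw : ∀ c : ℕ, (∑ U ∈ shellIn π S (2 * s₀ + c₀) (c - g), Φ ((U ∩ H₁).card : ℤ) ((U ∩ H₂).card : ℤ)) /
      ((shellIn π S (2 * s₀ + c₀) (c - g)).card : ℝ) =
      (∑ U ∈ shellIn π S (2 * s₀ + c₀) (c - g), ψ ((U ∩ (H₁ ∪ H₂)).card : ℤ)) /
        ((shellIn π S (2 * s₀ + c₀) (c - g)).card : ℝ) :=
    fun c => shellInAvg_two_blocks_eq hπ hπ' hS hdisj hno rfl rfl _ _ Φ
  simp_rw [hrw]
  exact piece_abs_le hπ hπ' hdes hS hN (H₁ ∪ H₂) h0 hb' hb'b hc₀ hR hR1 hR2 ψ hψG p hdeg hpz hp0 hP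

/-- **The bivariate main piece** (`g = 0`, odd reduced cut `2s₀+1`, virtual weight `p(0) ≥ 0`, mask `0 ≤ Φ ≤ G` for `x₁+x₂ ≤ b`):
one-sidedly `Σ_c w_c p(c)·E_{Shell_S(2s₀+1, c)}[Φ(X₁,X₂)] ≤ B_v·P·C((T−1)/2, D′+1)·G·(¼(b/R)²e^{3b/R})^{D′+1}`, by brick 151a
`piece_main_le` for the (nonnegative) mixture; needs `(b/R)²e^{3b/R} ≤ 2`.
[cite: Agarwal2000DifferenceEquations, Remark 1.8.1 (1.8.8)] [cite: RollinRoss2010, §3 (Lemma 3.1)] -/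
theorem piece_main_le₂ {t T D : ℕ} {Bv : ℝ} {C : Finset ℕ} {w : ℕ → ℝ} (hdes : IsExactDesign n t T D Bv C w)
    {S : Finset (Fin n)} (hS : ∀ v ∈ S, π v ∈ S) {N' : ℕ} (hN : S.card = 2 * N')
    {H₁ H₂ : Finset (Fin n)} (hdisj : Disjoint H₁ H₂) (h0 : (reps π (vAA π S (H₁ ∪ H₂))).card = 0)
    {b b' : ℕ} (hb' : (reps π (vBH π S (H₁ ∪ H₂) ∪ vBN π S (H₁ ∪ H₂))).card = b') (hb'b : b' ≤ b)
    {s₀ D' R : ℕ} (hR : 1 ≤ R)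
    (hR1 : R + 3 * (D' + 1) + b + (T - 1) / 2 ≤ s₀ + 1)
    (hR2 : R + 3 * (D' + 1) + b + s₀ + (T - 1) / 2 + 1 ≤ N')
    (hq : ((b : ℝ) / R) ^ 2 * Real.exp (3 * b / R) ≤ 2)
    (Φ : ℤ → ℤ → ℝ) {G : ℝ} (hG : ∀ x₁ x₂ : ℕ, x₁ + x₂ ≤ b → |Φ x₁ x₂| ≤ G)
    (hΦ0 : ∀ x₁ x₂ : ℕ, x₁ + x₂ ≤ b → 0 ≤ Φ x₁ x₂)
    (p : ℝ[X]) (hdeg : p.natDegree + D' ≤ D) (hp0 : 0 ≤ p.eval 0) {P : ℝ} (hP : ∀ c ∈ C, |p.eval (c : ℝ)| ≤ P) :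
    ∑ c ∈ C, w c * (p.eval (c : ℝ) *
        ((∑ U ∈ shellIn π S (2 * s₀ + 1) c, Φ ((U ∩ H₁).card : ℤ) ((U ∩ H₂).card : ℤ)) /
          ((shellIn π S (2 * s₀ + 1) c).card : ℝ))) ≤
      Bv * P * ((((T - 1) / 2).choose (D' + 1) : ℕ) : ℝ) *
        (G * ((1 / 4 : ℝ) * ((b : ℝ) / R) ^ 2 * Real.exp (3 * b / R)) ^ (D' + 1)) := by
  have hno := no_internal_edge_of_reps_vAA hπ hπ' hS (H₁ ∪ H₂) h0
  have hbb : (S ∩ H₁).card + (S ∩ H₂).card ≤ b := by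
    rw [Summit.PneNP.PneNP.Theorems.ChebyshevTracialDesignTwoBlockMixture.card_inter_add_card_inter_eq hdisj S,
      ← card_reps_vB_eq_card_inter hπ hπ' hS (H₁ ∪ H₂) hno, hb']
    exact hb'b
  set ψ : ℤ → ℝ := fun x => ∑ x₁ ∈ range ((S ∩ H₁).card + 1), ∑ x₂ ∈ range ((S ∩ H₂).card + 1),
    (if ((x₁ + x₂ : ℕ) : ℤ) = x then (((S ∩ H₁).card.choose x₁ * (S ∩ H₂).card.choose x₂ : ℕ) : ℝ) /
      ((((S ∩ H₁).card + (S ∩ H₂).card).choose (x₁ + x₂) : ℕ) : ℝ) else 0) * Φ x₁ x₂ with hψ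
  have hGr : ∀ x₁ ∈ range ((S ∩ H₁).card + 1), ∀ x₂ ∈ range ((S ∩ H₂).card + 1), |Φ x₁ x₂| ≤ G := by
    intro x₁ hx₁ x₂ hx₂
    rw [mem_range] at hx₁ hx₂
    exact hG x₁ x₂ (by omega)
  have h0r : ∀ x₁ ∈ range ((S ∩ H₁).card + 1), ∀ x₂ ∈ range ((S ∩ H₂).card + 1), 0 ≤ Φ x₁ x₂ := by
    intro x₁ hx₁ x₂ hx₂
    rw [mem_range] at hx₁ hx₂
    exact hΦ0 x₁ x₂ (by omega)
  have hψG : ∀ x ∈ Icc (0 : ℤ) ((2 * s₀ + 1 : ℕ) : ℤ), |ψ x| ≤ G := fun x _ => abs_mixture_le _ _ Φ hGr x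
  have hψ0 : ∀ x ∈ Icc (0 : ℤ) ((2 * s₀ + 1 : ℕ) : ℤ), 0 ≤ ψ x := fun x _ => mixture_nonneg _ _ Φ h0r x
  have hrw : ∀ c : ℕ, (∑ U ∈ shellIn π S (2 * s₀ + 1) c, Φ ((U ∩ H₁).card : ℤ) ((U ∩ H₂).card : ℤ)) /
      ((shellIn π S (2 * s₀ + 1) c).card : ℝ) =
      (∑ U ∈ shellIn π S (2 * s₀ + 1) c, ψ ((U ∩ (H₁ ∪ H₂)).card : ℤ)) / ((shellIn π S (2 * s₀ + 1) c).card : ℝ) :=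
    fun c => shellInAvg_two_blocks_eq hπ hπ' hS hdisj hno rfl rfl _ _ Φ
  simp_rw [hrw]
  exact piece_main_le hπ hπ' hdes hS hN (H₁ ∪ H₂) h0 hb' hb'b hR hR1 hR2 hq ψ hψG hψ0 p hdeg hp0 hP

end Piece

end Summit.PneNP.PneNP.Theorems.ChebyshevTracialDesignTwoBlockTools

end
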